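import Summits.HubbardSuperconductivity.HubbardSuperconductivity.Theorems.AnisotropyChordTransferFibre3RowDMonoTransform

/-!
# Route `AnisotropyChord` / H0 rotor rung: PartN41-D §4 — `MFormTransform` PROVED (the spectator monomial transforms to translates of `Π̂_P`)

Theory-1 g22's PartN41-D §4 `MFormTransform` (port …Fibre3KT2aRow): the transform of the trilinear spectator form `mform3(Fa,Fb,Fc)` is
`−½Σ_{e=±x̂}(e^{iK₁·e} − 1)[(e^{−i(k₂+k₃)·e} − 1)Π̂_P(k) + (e^{i(k₂−K₁)·e} − 1)Π̂_P(k₂−K₁,k₃) + (e^{i(k₃−K₁)·e} − 1)Π̂_P(k₂,k₃−K₁)]`,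
from three shift rules for `cfgDFT` (★ `cfgDFT_shift_diag`, ★ `cfgDFT_phase1_shift`, ★ `cfgDFT_phase2_shift`) and linearity.
★ `mFormTransform_holds : MFormTransform L`.
Prover seat `hubbard-h0-rotor-p1` g27 (route lead); helper for stmt-HubbardSuperconductivity-23918 (`--supports`, helper class).
WHAT THIS IS NOT: nothing here proves superconductivity in the Hubbard model.  Tree imports only; no new definitions; no sorry.
-/

set_option linter.dupNamespace false
set_option autoImplicit false

noncomputable section

open scoped BigOperators

namespace Summit.HubbardSuperconductivity.HubbardSuperconductivity.Theorems.AnisotropyChord.Transfer.Fibre3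

variable (L : ℕ) [NeZero L]

namespace RowD

/-- diagonal shift: `cfgDFT[G(· − (e,e))](k) = e^{−i(k₂+k₃)·e}·Ĝ(k)`. [folklore] -/
theorem cfgDFT_shift_diag (G : Cfg L → ℂ) (e k₂ k₃ : Tor L) :
    cfgDFT L (fun c => G (c.1 - e, c.2 - e)) k₂ k₃ = (starRingEnd ℂ) (phase L (k₂ + k₃) e) * cfgDFT L G k₂ k₃ := by
  unfold cfgDFT
  rw [Finset.mul_sum]
  refine Fintype.sum_equiv (Equiv.subRight ((e, e) : Cfg L)) _ _ (fun c => ?_)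
  rw [Equiv.subRight_apply]
  show (starRingEnd ℂ) (phase L k₂ c.1 * phase L k₃ c.2) * G (c.1 - e, c.2 - e)
    = (starRingEnd ℂ) (phase L (k₂ + k₃) e) * ((starRingEnd ℂ) (phase L k₂ (c - (e, e)).1 * phase L k₃ (c - (e, e)).2) * G (c - (e, e)))
  have e1 : c - (e, e) = (c.1 - e, c.2 - e) := rfl
  rw [e1]
  simp only
  have h1 : phase L k₂ c.1 = phase L k₂ (c.1 - e) * phase L k₂ e := by rw [← phase_add, sub_add_cancel]
  have h2 : phase L k₃ c.2 = phase L k₃ (c.2 - e) * phase L k₃ e := by rw [← phase_add, sub_add_cancel]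
  rw [h1, h2, phase_add_left]
  simp only [map_mul]
  ring

/-- `e^{iK₁a}`-weighted shift in the first coordinate: `cfgDFT[φ_{K₁}(a)G(a + e, b)](k) = e^{i(k₂−K₁)·e}·Ĝ(k₂ − K₁, k₃)`. [folklore] -/
theorem cfgDFT_phase1_shift (G : Cfg L → ℂ) (e k₂ k₃ : Tor L) :
    cfgDFT L (fun c => phase L (K1 L) c.1 * G (c.1 + e, c.2)) k₂ k₃ = phase L (k₂ - K1 L) e * cfgDFT L G (k₂ - K1 L) k₃ := by
  unfold cfgDFT
  rw [Finset.mul_sum]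
  refine Fintype.sum_equiv (Equiv.prodCongr (Equiv.addRight e) (Equiv.refl (Tor L))) _ _ (fun c => ?_)
  show (starRingEnd ℂ) (phase L k₂ c.1 * phase L k₃ c.2) * (phase L (K1 L) c.1 * G (c.1 + e, c.2))
    = phase L (k₂ - K1 L) e * ((starRingEnd ℂ) (phase L (k₂ - K1 L) (c.1 + e) * phase L k₃ c.2) * G (c.1 + e, c.2))
  have hA : (starRingEnd ℂ) (phase L (k₂ - K1 L) (c.1 + e))
      = (starRingEnd ℂ) (phase L k₂ c.1) * phase L (K1 L) c.1 * phase L (k₂ - K1 L) (-e) := by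
    rw [phase_add, map_mul, conj_phase_sub_K1, conj_phase L (k₂ - K1 L) e]
  have h := phase_mul_neg L (k₂ - K1 L) e
  simp only [map_mul]
  rw [hA]
  linear_combination (-((starRingEnd ℂ) (phase L k₂ c.1) * phase L (K1 L) c.1 * (starRingEnd ℂ) (phase L k₃ c.2)
    * G (c.1 + e, c.2))) * h

/-- the same with no shift: `cfgDFT[φ_{K₁}(a)G](k) = Ĝ(k₂ − K₁, k₃)`. [folklore] -/
theorem cfgDFT_phase1 (G : Cfg L → ℂ) (k₂ k₃ : Tor L) :
    cfgDFT L (fun c => phase L (K1 L) c.1 * G c) k₂ k₃ = cfgDFT L G (k₂ - K1 L) k₃ := by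
  have h := cfgDFT_phase1_shift L G 0 k₂ k₃
  simp only [add_zero, phase_zero, one_mul] at h
  exact h

/-- `e^{iK₁b}`-weighted shift in the second coordinate. [folklore] -/
theorem cfgDFT_phase2_shift (G : Cfg L → ℂ) (e k₂ k₃ : Tor L) :
    cfgDFT L (fun c => phase L (K1 L) c.2 * G (c.1, c.2 + e)) k₂ k₃ = phase L (k₃ - K1 L) e * cfgDFT L G k₂ (k₃ - K1 L) := by
  unfold cfgDFT
  rw [Finset.mul_sum]
  refine Fintype.sum_equiv (Equiv.prodCongr (Equiv.refl (Tor L)) (Equiv.addRight e)) _ _ (fun c => ?_)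
  show (starRingEnd ℂ) (phase L k₂ c.1 * phase L k₃ c.2) * (phase L (K1 L) c.2 * G (c.1, c.2 + e))
    = phase L (k₃ - K1 L) e * ((starRingEnd ℂ) (phase L k₂ c.1 * phase L (k₃ - K1 L) (c.2 + e)) * G (c.1, c.2 + e))
  have hA : (starRingEnd ℂ) (phase L (k₃ - K1 L) (c.2 + e))
      = (starRingEnd ℂ) (phase L k₃ c.2) * phase L (K1 L) c.2 * phase L (k₃ - K1 L) (-e) := by
    rw [phase_add, map_mul, conj_phase_sub_K1, conj_phase L (k₃ - K1 L) e]
  have h := phase_mul_neg L (k₃ - K1 L) e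
  simp only [map_mul]
  rw [hA]
  linear_combination (-((starRingEnd ℂ) (phase L k₂ c.1) * (starRingEnd ℂ) (phase L k₃ c.2) * phase L (K1 L) c.2
    * G (c.1, c.2 + e))) * h

/-- the same with no shift. [folklore] -/
theorem cfgDFT_phase2 (G : Cfg L → ℂ) (k₂ k₃ : Tor L) :
    cfgDFT L (fun c => phase L (K1 L) c.2 * G c) k₂ k₃ = cfgDFT L G k₂ (k₃ - K1 L) := by
  have h := cfgDFT_phase2_shift L G 0 k₂ k₃
  simp only [add_zero, phase_zero, one_mul] at h
  exact h

/-- `cfgDFT` respects subtraction. [folklore] -/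
theorem cfgDFT_sub'' (F G : Cfg L → ℂ) (k₂ k₃ : Tor L) :
    cfgDFT L (fun c => F c - G c) k₂ k₃ = cfgDFT L F k₂ k₃ - cfgDFT L G k₂ k₃ := by
  unfold cfgDFT; rw [← Finset.sum_sub_distrib]; exact Finset.sum_congr rfl fun c _ => by ring

/-- the transform of one directional spectator term. [folklore] -/
theorem cfgDFT_mterm (Fa Fb Fc : Tor L → ℝ) (e k₂ k₃ : Tor L) :
    cfgDFT L (fun c => (phase L (K1 L) e - 1) *
        ( ((prod3 L Fa Fb Fc (c.1 - e, c.2 - e) - prod3 L Fa Fb Fc c : ℝ) : ℂ)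
        + phase L (K1 L) c.1 * ((prod3 L Fa Fb Fc (c.1 + e, c.2) - prod3 L Fa Fb Fc c : ℝ) : ℂ)
        + phase L (K1 L) c.2 * ((prod3 L Fa Fb Fc (c.1, c.2 + e) - prod3 L Fa Fb Fc c : ℝ) : ℂ))) k₂ k₃
      = (phase L (K1 L) e - 1) *
        ( ((starRingEnd ℂ) (phase L (k₂ + k₃) e) - 1) * cfgDFT L (fun c => ((prod3 L Fa Fb Fc c : ℝ) : ℂ)) k₂ k₃
        + (phase L (k₂ - K1 L) e - 1) * cfgDFT L (fun c => ((prod3 L Fa Fb Fc c : ℝ) : ℂ)) (k₂ - K1 L) k₃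
        + (phase L (k₃ - K1 L) e - 1) * cfgDFT L (fun c => ((prod3 L Fa Fb Fc c : ℝ) : ℂ)) k₂ (k₃ - K1 L)) := by
  set P : Cfg L → ℂ := fun c => ((prod3 L Fa Fb Fc c : ℝ) : ℂ) with hP
  have hfun : (fun c => (phase L (K1 L) e - 1) *
        ( ((prod3 L Fa Fb Fc (c.1 - e, c.2 - e) - prod3 L Fa Fb Fc c : ℝ) : ℂ)
        + phase L (K1 L) c.1 * ((prod3 L Fa Fb Fc (c.1 + e, c.2) - prod3 L Fa Fb Fc c : ℝ) : ℂ)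
        + phase L (K1 L) c.2 * ((prod3 L Fa Fb Fc (c.1, c.2 + e) - prod3 L Fa Fb Fc c : ℝ) : ℂ)))
      = fun c => (phase L (K1 L) e - 1) *
        (((P (c.1 - e, c.2 - e) - P c) + (phase L (K1 L) c.1 * P (c.1 + e, c.2) - phase L (K1 L) c.1 * P c))
          + (phase L (K1 L) c.2 * P (c.1, c.2 + e) - phase L (K1 L) c.2 * P c)) := by
    funext c; rw [hP]; push_cast; ring
  rw [hfun, cfgDFT_smul', cfgDFT_add', cfgDFT_add', cfgDFT_sub'', cfgDFT_sub'', cfgDFT_sub'',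
    cfgDFT_shift_diag, cfgDFT_phase1_shift, cfgDFT_phase1, cfgDFT_phase2_shift, cfgDFT_phase2]
  ring

end RowD

/-- ★ **`MFormTransform L` holds.** [folklore] -/
theorem mFormTransform_holds : MFormTransform L := by
  intro Fa Fb Fc k₂ k₃
  have hfun : mform3 L Fa Fb Fc = fun c => -(1 / 2 : ℂ) *
      ((fun c => (phase L (K1 L) (ex L) - 1) *
        ( ((prod3 L Fa Fb Fc (c.1 - ex L, c.2 - ex L) - prod3 L Fa Fb Fc c : ℝ) : ℂ)
        + phase L (K1 L) c.1 * ((prod3 L Fa Fb Fc (c.1 + ex L, c.2) - prod3 L Fa Fb Fc c : ℝ) : ℂ)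
        + phase L (K1 L) c.2 * ((prod3 L Fa Fb Fc (c.1, c.2 + ex L) - prod3 L Fa Fb Fc c : ℝ) : ℂ))) c
      + (fun c => (phase L (K1 L) (-ex L) - 1) *
        ( ((prod3 L Fa Fb Fc (c.1 - -ex L, c.2 - -ex L) - prod3 L Fa Fb Fc c : ℝ) : ℂ)
        + phase L (K1 L) c.1 * ((prod3 L Fa Fb Fc (c.1 + -ex L, c.2) - prod3 L Fa Fb Fc c : ℝ) : ℂ)
        + phase L (K1 L) c.2 * ((prod3 L Fa Fb Fc (c.1, c.2 + -ex L) - prod3 L Fa Fb Fc c : ℝ) : ℂ))) c) := by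
    funext c
    unfold mform3
    simp only [List.map_cons, List.map_nil, List.sum_cons, List.sum_nil, add_zero]
  rw [hfun, RowD.cfgDFT_smul', RowD.cfgDFT_add', RowD.cfgDFT_mterm, RowD.cfgDFT_mterm]
  simp only [List.map_cons, List.map_nil, List.sum_cons, List.sum_nil, add_zero]

end Summit.HubbardSuperconductivity.HubbardSuperconductivity.Theorems.AnisotropyChord.Transfer.Fibre3

end
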